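import Summits.QuantumFields.YangMills.Theorems.VirialFluxGapRingChartPhase
import HarnessLib

/-!
# Size bounds of the chart model of the twisted ring deficit: `0 ≤ Q ≤ 96L⁴m²`, `|C| ≤ 288L⁴m³`
# (layer (B3-phase), constants, of the DIRECT Laplace road to ⟨stmt-QuantumFields-24204⟩ `VirialFluxGap.SharpTwistedLaplace`)

Helper module (free-hands work of width seat ym-line-sfw-p2-w3 g56, cell ym-idea-1; `--supports 24204`).  Companion of
✓`ChartPhase.abs_ringDeficit_sub_chartModel_le` (`|F_z(P) − (Q − C)| ≤ 6720L⁴m⁴` in the LEFT product exponential chart at a zero of `F_z`):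
with the SAME parameter pack (skew-Hermitian `A_{i,e}`, `B_x` of Frobenius norm `≤ m`, transported perturbations `X₂, X₃, Y₂, Y₃`),
* `chartModel_quad_nonneg`, ★ `chartModel_quad_le` — `0 ≤ Q(A,B) ≤ 96·L⁴·m²` (each of the `12L⁴` terms is `½‖S_t‖² ≤ 8m²`, the transports being
  Frobenius isometries ✓`frobenius_norm_unitary_conj`); so along an isometric linear slice the Hessian operator `𝔸` of `½⟪𝔸y,y⟫ = Q(ιy)` has
  `‖𝔸‖ ≤ 192L⁴`, whence `log det 𝔸 ≤ 18L⁴·log(192L⁴)` in the one-loop constant;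
* ★ `abs_chartModel_cubic_le` — `|C(A,B)| ≤ 288·L⁴·m³` (each term `≤ 24m³`, ✓`abs_cubicForm_le`): the constant `A₃` of
  ✓`QuantitativeLaplace.laplaceMethod_quantitative_of_eqOn` (with `A₄ = 6720L⁴` from the companion file).

Everything here is PROVED; no definitions, no named facts (namespace `Summit.QuantumFields.YangMills.Theorems.VirialFluxGap.ChartPhase`).
HONEST FRAMING: bookkeeping; ⟨24204⟩, ⟨24319⟩ and every rung stay OPEN; the Yang–Mills mass gap (Clay) is NOT touched; no summit is proved by a line.

## References
* K. W. Breitung, *Asymptotic Approximations for Probability Integrals*, LNM 1592 (1994), Lemma 7 p. 12. [Breitung1994]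
* M. Lüscher, Nucl. Phys. B219 (1983), §2. [Luscher1983]
-/

set_option autoImplicit false

noncomputable section

open scoped Matrix Matrix.Norms.Frobenius BigOperators
open NormedSpace
open Literature.MathematicalPhysics.QuantumFieldTheory hiding SU2
open Literature.MathematicalPhysics.QuantumLattice
open Summit.QuantumFields.YangMills.Theorems.FemtoTransferGap
open Summit.QuantumFields.YangMills.Theorems.FemtoTransferGap.TT
open Summit.QuantumFields.YangMills.Theorems.VirialFluxGap.RingDeficit
open Summit.QuantumFields.YangMills.Theorems.ColdBoxAllGroups (norm_commutator_le)

namespace Summit.QuantumFields.YangMills.Theorems.VirialFluxGap.ChartPhase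

variable {L : ℕ} [NeZero L]

/-- A sum of terms each at most `c` is at most `card · c`. [folklore] -/
theorem sum_le_card_mul' {ι : Type*} [Fintype ι] {f : ι → ℝ} {c : ℝ} (h : ∀ i, f i ≤ c) : ∑ i, f i ≤ Fintype.card ι * c :=
  calc ∑ i, f i ≤ ∑ _i : ι, c := Finset.sum_le_sum fun i _ => h i
    _ = Fintype.card ι * c := by rw [Finset.sum_const, Finset.card_univ, nsmul_eq_mul]

/-- A sum of terms each at most `c` in absolute value is at most `card · c` in absolute value. [folklore] -/
theorem abs_sum_le_card_mul' {ι : Type*} [Fintype ι] {f : ι → ℝ} {c : ℝ} (h : ∀ i, |f i| ≤ c) : |∑ i, f i| ≤ Fintype.card ι * c :=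
  (Finset.abs_sum_le_sum_abs _ _).trans (sum_le_card_mul' h)

/-- The temporal quadratic piece: `½‖A − A'‖² ≤ 8m²`. [folklore] -/
theorem half_norm_sub_sq_le {A A' : Matrix (Fin 2) (Fin 2) ℂ} {m : ℝ} (h : ‖A‖ ≤ m) (h' : ‖A'‖ ≤ m) : ‖A - A'‖ ^ 2 / 2 ≤ 8 * m ^ 2 := by
  have hm0 : 0 ≤ m := (norm_nonneg _).trans h
  have h1 : ‖A - A'‖ ≤ 2 * m := (norm_sub_le _ _).trans (by linarith)
  have h2 : ‖A - A'‖ ^ 2 ≤ (2 * m) ^ 2 := pow_le_pow_left₀ (norm_nonneg _) h1 2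
  nlinarith

/-- The temporal cubic piece: `|½Re tr((A − A')(AA' − A'A))| ≤ 24m³` (in fact it vanishes). [folklore] -/
theorem abs_temporal_cubic_le {A A' : Matrix (Fin 2) (Fin 2) ℂ} {m : ℝ} (h : ‖A‖ ≤ m) (h' : ‖A'‖ ≤ m) :
    |-(((A - A') * (A * A' - A' * A)).trace.re / 2)| ≤ 24 * m ^ 3 := by
  have hm0 : 0 ≤ m := (norm_nonneg _).trans h
  have h1 : ‖A - A'‖ ≤ 2 * m := (norm_sub_le _ _).trans (by linarith)
  have h2 : ‖A * A' - A' * A‖ ≤ 2 * m ^ 2 := norm_commutator_le h h'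
  have h3 := ColdBoxAllGroups.abs_re_trace_mul_le (A - A') (A * A' - A' * A)
  have h4 : |((A - A') * (A * A' - A' * A)).trace.re| ≤ (2 * m) * (2 * m ^ 2) := h3.trans (mul_le_mul h1 h2 (norm_nonneg _) (by positivity))
  rw [abs_neg, abs_div, abs_two, div_le_iff₀ (by norm_num : (0:ℝ) < 2)]
  nlinarith [pow_nonneg hm0 3]

/-- ★ **The quadratic form of the chart model is non-negative.** [folklore] -/
theorem chartModel_quad_nonneg (A : Fin (2 * L - 1 + 1) → Edge 3 L → Matrix (Fin 2) (Fin 2) ℂ) (B : Site 3 L → Matrix (Fin 2) (Fin 2) ℂ)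
    (X₂ X₃ : Edge 3 L → Matrix (Fin 2) (Fin 2) ℂ) (Y₂ Y₃ : Fin (2 * L - 1 + 1) → Plaquette 3 L → Matrix (Fin 2) (Fin 2) ℂ) :
    0 ≤ ((∑ i : Fin (2 * L - 1), ∑ e : Edge 3 L, ‖A i.castSucc e - A i.succ e‖ ^ 2 / 2) +
          (∑ e : Edge 3 L, ‖A (Fin.last (2 * L - 1)) e + X₂ e - X₃ e - B e.1‖ ^ 2 / 2) +
          ∑ i : Fin (2 * L - 1 + 1), ∑ p : Plaquette 3 L, ‖A i (p.1, p.2.1.1) + Y₂ i p - Y₃ i p - A i (p.1, p.2.1.2)‖ ^ 2 / 2) := by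
  positivity

/-- ★ **The quadratic form of the chart model is at most `96L⁴m²`** (each of the `12L⁴` terms is `½‖S_t‖² ≤ 8m²`; the transports are Frobenius
isometries). [cite: Luscher1983, §2] -/
theorem chartModel_quad_le {R : (Fin (2 * L - 1 + 1) → GaugeConfig 3 L SU2) × (Site 3 L → SU2)}
    (A : Fin (2 * L - 1 + 1) → Edge 3 L → Matrix (Fin 2) (Fin 2) ℂ) (B : Site 3 L → Matrix (Fin 2) (Fin 2) ℂ)
    {m : ℝ} (hAm : ∀ i e, ‖A i e‖ ≤ m) (hBm : ∀ x, ‖B x‖ ≤ m)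
    (X₂ X₃ : Edge 3 L → Matrix (Fin 2) (Fin 2) ℂ)
    (hX₂ : ∀ e, X₂ e = (R.1 0 e : Matrix (Fin 2) (Fin 2) ℂ) * B (e.1.shift e.2) * (R.1 0 e : Matrix (Fin 2) (Fin 2) ℂ)ᴴ)
    (hX₃ : ∀ e, X₃ e = ((R.1 0 e : Matrix (Fin 2) (Fin 2) ℂ) * (R.2 (e.1.shift e.2) : Matrix (Fin 2) (Fin 2) ℂ) * (R.1 0 e : Matrix (Fin 2) (Fin 2) ℂ)ᴴ) *
        A 0 e * ((R.1 0 e : Matrix (Fin 2) (Fin 2) ℂ) * (R.2 (e.1.shift e.2) : Matrix (Fin 2) (Fin 2) ℂ) * (R.1 0 e : Matrix (Fin 2) (Fin 2) ℂ)ᴴ)ᴴ)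
    (Y₂ Y₃ : Fin (2 * L - 1 + 1) → Plaquette 3 L → Matrix (Fin 2) (Fin 2) ℂ)
    (hY₂ : ∀ i p, Y₂ i p = (R.1 0 (p.1, p.2.1.1) : Matrix (Fin 2) (Fin 2) ℂ) * A i (p.1.shift p.2.1.1, p.2.1.2) *
        (R.1 0 (p.1, p.2.1.1) : Matrix (Fin 2) (Fin 2) ℂ)ᴴ)
    (hY₃ : ∀ i p, Y₃ i p = ((R.1 0 (p.1, p.2.1.1) : Matrix (Fin 2) (Fin 2) ℂ) * (R.1 0 (p.1.shift p.2.1.1, p.2.1.2) : Matrix (Fin 2) (Fin 2) ℂ) *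
          (R.1 0 (p.1.shift p.2.1.2, p.2.1.1) : Matrix (Fin 2) (Fin 2) ℂ)ᴴ) * A i (p.1.shift p.2.1.2, p.2.1.1) *
        ((R.1 0 (p.1, p.2.1.1) : Matrix (Fin 2) (Fin 2) ℂ) * (R.1 0 (p.1.shift p.2.1.1, p.2.1.2) : Matrix (Fin 2) (Fin 2) ℂ) *
          (R.1 0 (p.1.shift p.2.1.2, p.2.1.1) : Matrix (Fin 2) (Fin 2) ℂ)ᴴ)ᴴ) :
    ((∑ i : Fin (2 * L - 1), ∑ e : Edge 3 L, ‖A i.castSucc e - A i.succ e‖ ^ 2 / 2) +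
          (∑ e : Edge 3 L, ‖A (Fin.last (2 * L - 1)) e + X₂ e - X₃ e - B e.1‖ ^ 2 / 2) +
          ∑ i : Fin (2 * L - 1 + 1), ∑ p : Plaquette 3 L, ‖A i (p.1, p.2.1.1) + Y₂ i p - Y₃ i p - A i (p.1, p.2.1.2)‖ ^ 2 / 2) ≤
      96 * (L : ℝ) ^ 4 * m ^ 2 := by
  -- norms of the transported perturbations
  have hX₂n : ∀ e, ‖X₂ e‖ ≤ m := fun e => by
    rw [hX₂, frobenius_norm_unitary_conj (R.1 0 e).prop.1]; exact hBm _
  have hX₃n : ∀ e, ‖X₃ e‖ ≤ m := fun e => by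
    have hW : (R.1 0 e : Matrix (Fin 2) (Fin 2) ℂ) * (R.2 (e.1.shift e.2) : Matrix (Fin 2) (Fin 2) ℂ) * (R.1 0 e : Matrix (Fin 2) (Fin 2) ℂ)ᴴ ∈
        Matrix.unitaryGroup (Fin 2) ℂ :=
      mul_mem (mul_mem (R.1 0 e).prop.1 (R.2 (e.1.shift e.2)).prop.1) (conjTranspose_mem_unitaryGroup (R.1 0 e).prop.1)
    rw [hX₃, frobenius_norm_unitary_conj hW]; exact hAm _ _
  have hY₂n : ∀ i p, ‖Y₂ i p‖ ≤ m := fun i p => by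
    rw [hY₂, frobenius_norm_unitary_conj (R.1 0 (p.1, p.2.1.1)).prop.1]; exact hAm _ _
  have hY₃n : ∀ i p, ‖Y₃ i p‖ ≤ m := fun i p => by
    have hW : (R.1 0 (p.1, p.2.1.1) : Matrix (Fin 2) (Fin 2) ℂ) * (R.1 0 (p.1.shift p.2.1.1, p.2.1.2) : Matrix (Fin 2) (Fin 2) ℂ) *
        (R.1 0 (p.1.shift p.2.1.2, p.2.1.1) : Matrix (Fin 2) (Fin 2) ℂ)ᴴ ∈ Matrix.unitaryGroup (Fin 2) ℂ :=
      mul_mem (mul_mem (R.1 0 _).prop.1 (R.1 0 _).prop.1) (conjTranspose_mem_unitaryGroup (R.1 0 _).prop.1)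
    rw [hY₃, frobenius_norm_unitary_conj hW]; exact hAm _ _
  have hT : (∑ i : Fin (2 * L - 1), ∑ e : Edge 3 L, ‖A i.castSucc e - A i.succ e‖ ^ 2 / 2) ≤
      Fintype.card (Fin (2 * L - 1)) * (Fintype.card (Edge 3 L) * (8 * m ^ 2)) :=
    sum_le_card_mul' fun i => sum_le_card_mul' fun e => half_norm_sub_sq_le (hAm _ _) (hAm _ _)
  have hS : (∑ e : Edge 3 L, ‖A (Fin.last (2 * L - 1)) e + X₂ e - X₃ e - B e.1‖ ^ 2 / 2) ≤ Fintype.card (Edge 3 L) * (8 * m ^ 2) :=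
    sum_le_card_mul' fun e => half_norm_circulation_sq_le (hAm _ _) (hX₂n e) (hX₃n e) (hBm _)
  have hP : (∑ i : Fin (2 * L - 1 + 1), ∑ p : Plaquette 3 L, ‖A i (p.1, p.2.1.1) + Y₂ i p - Y₃ i p - A i (p.1, p.2.1.2)‖ ^ 2 / 2) ≤
      Fintype.card (Fin (2 * L - 1 + 1)) * (Fintype.card (Plaquette 3 L) * (8 * m ^ 2)) :=
    sum_le_card_mul' fun i => sum_le_card_mul' fun p => half_norm_circulation_sq_le (hAm _ _) (hY₂n i p) (hY₃n i p) (hAm _ _)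
  have hsum := add_le_add (add_le_add hT hS) hP
  rw [familyCards_mul_eq L (8 * m ^ 2)] at hsum
  linarith

/-- ★ **The cubic form of the chart model is at most `288L⁴m³` in absolute value** (each term `≤ 24m³`). This is the constant `A₃` of the
quantitative Laplace method along a slice. [cite: Breitung1994, Lemma 7 p. 12] -/
theorem abs_chartModel_cubic_le {R : (Fin (2 * L - 1 + 1) → GaugeConfig 3 L SU2) × (Site 3 L → SU2)}
    (A : Fin (2 * L - 1 + 1) → Edge 3 L → Matrix (Fin 2) (Fin 2) ℂ) (B : Site 3 L → Matrix (Fin 2) (Fin 2) ℂ)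
    {m : ℝ} (hAm : ∀ i e, ‖A i e‖ ≤ m) (hBm : ∀ x, ‖B x‖ ≤ m)
    (X₂ X₃ : Edge 3 L → Matrix (Fin 2) (Fin 2) ℂ)
    (hX₂ : ∀ e, X₂ e = (R.1 0 e : Matrix (Fin 2) (Fin 2) ℂ) * B (e.1.shift e.2) * (R.1 0 e : Matrix (Fin 2) (Fin 2) ℂ)ᴴ)
    (hX₃ : ∀ e, X₃ e = ((R.1 0 e : Matrix (Fin 2) (Fin 2) ℂ) * (R.2 (e.1.shift e.2) : Matrix (Fin 2) (Fin 2) ℂ) * (R.1 0 e : Matrix (Fin 2) (Fin 2) ℂ)ᴴ) *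
        A 0 e * ((R.1 0 e : Matrix (Fin 2) (Fin 2) ℂ) * (R.2 (e.1.shift e.2) : Matrix (Fin 2) (Fin 2) ℂ) * (R.1 0 e : Matrix (Fin 2) (Fin 2) ℂ)ᴴ)ᴴ)
    (Y₂ Y₃ : Fin (2 * L - 1 + 1) → Plaquette 3 L → Matrix (Fin 2) (Fin 2) ℂ)
    (hY₂ : ∀ i p, Y₂ i p = (R.1 0 (p.1, p.2.1.1) : Matrix (Fin 2) (Fin 2) ℂ) * A i (p.1.shift p.2.1.1, p.2.1.2) *
        (R.1 0 (p.1, p.2.1.1) : Matrix (Fin 2) (Fin 2) ℂ)ᴴ)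
    (hY₃ : ∀ i p, Y₃ i p = ((R.1 0 (p.1, p.2.1.1) : Matrix (Fin 2) (Fin 2) ℂ) * (R.1 0 (p.1.shift p.2.1.1, p.2.1.2) : Matrix (Fin 2) (Fin 2) ℂ) *
          (R.1 0 (p.1.shift p.2.1.2, p.2.1.1) : Matrix (Fin 2) (Fin 2) ℂ)ᴴ) * A i (p.1.shift p.2.1.2, p.2.1.1) *
        ((R.1 0 (p.1, p.2.1.1) : Matrix (Fin 2) (Fin 2) ℂ) * (R.1 0 (p.1.shift p.2.1.1, p.2.1.2) : Matrix (Fin 2) (Fin 2) ℂ) *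
          (R.1 0 (p.1.shift p.2.1.2, p.2.1.1) : Matrix (Fin 2) (Fin 2) ℂ)ᴴ)ᴴ) :
    |(∑ i : Fin (2 * L - 1), ∑ e : Edge 3 L,
            -(((A i.castSucc e - A i.succ e) * (A i.castSucc e * A i.succ e - A i.succ e * A i.castSucc e)).trace.re / 2)) +
          (∑ e : Edge 3 L,
            ((A (Fin.last (2 * L - 1)) e + X₂ e - X₃ e - B e.1) *
              ((A (Fin.last (2 * L - 1)) e * X₂ e - X₂ e * A (Fin.last (2 * L - 1)) e) -
                (A (Fin.last (2 * L - 1)) e * X₃ e - X₃ e * A (Fin.last (2 * L - 1)) e) -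
                (A (Fin.last (2 * L - 1)) e * B e.1 - B e.1 * A (Fin.last (2 * L - 1)) e) - (X₂ e * X₃ e - X₃ e * X₂ e) -
                (X₂ e * B e.1 - B e.1 * X₂ e) + (X₃ e * B e.1 - B e.1 * X₃ e))).trace.re / 2) +
          ∑ i : Fin (2 * L - 1 + 1), ∑ p : Plaquette 3 L,
            ((A i (p.1, p.2.1.1) + Y₂ i p - Y₃ i p - A i (p.1, p.2.1.2)) *
              ((A i (p.1, p.2.1.1) * Y₂ i p - Y₂ i p * A i (p.1, p.2.1.1)) - (A i (p.1, p.2.1.1) * Y₃ i p - Y₃ i p * A i (p.1, p.2.1.1)) -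
                (A i (p.1, p.2.1.1) * A i (p.1, p.2.1.2) - A i (p.1, p.2.1.2) * A i (p.1, p.2.1.1)) - (Y₂ i p * Y₃ i p - Y₃ i p * Y₂ i p) -
                (Y₂ i p * A i (p.1, p.2.1.2) - A i (p.1, p.2.1.2) * Y₂ i p) + (Y₃ i p * A i (p.1, p.2.1.2) - A i (p.1, p.2.1.2) * Y₃ i p))).trace.re / 2| ≤
      288 * (L : ℝ) ^ 4 * m ^ 3 := by
  have hX₂n : ∀ e, ‖X₂ e‖ ≤ m := fun e => by
    rw [hX₂, frobenius_norm_unitary_conj (R.1 0 e).prop.1]; exact hBm _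
  have hX₃n : ∀ e, ‖X₃ e‖ ≤ m := fun e => by
    have hW : (R.1 0 e : Matrix (Fin 2) (Fin 2) ℂ) * (R.2 (e.1.shift e.2) : Matrix (Fin 2) (Fin 2) ℂ) * (R.1 0 e : Matrix (Fin 2) (Fin 2) ℂ)ᴴ ∈
        Matrix.unitaryGroup (Fin 2) ℂ :=
      mul_mem (mul_mem (R.1 0 e).prop.1 (R.2 (e.1.shift e.2)).prop.1) (conjTranspose_mem_unitaryGroup (R.1 0 e).prop.1)
    rw [hX₃, frobenius_norm_unitary_conj hW]; exact hAm _ _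
  have hY₂n : ∀ i p, ‖Y₂ i p‖ ≤ m := fun i p => by
    rw [hY₂, frobenius_norm_unitary_conj (R.1 0 (p.1, p.2.1.1)).prop.1]; exact hAm _ _
  have hY₃n : ∀ i p, ‖Y₃ i p‖ ≤ m := fun i p => by
    have hW : (R.1 0 (p.1, p.2.1.1) : Matrix (Fin 2) (Fin 2) ℂ) * (R.1 0 (p.1.shift p.2.1.1, p.2.1.2) : Matrix (Fin 2) (Fin 2) ℂ) *
        (R.1 0 (p.1.shift p.2.1.2, p.2.1.1) : Matrix (Fin 2) (Fin 2) ℂ)ᴴ ∈ Matrix.unitaryGroup (Fin 2) ℂ :=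
      mul_mem (mul_mem (R.1 0 _).prop.1 (R.1 0 _).prop.1) (conjTranspose_mem_unitaryGroup (R.1 0 _).prop.1)
    rw [hY₃, frobenius_norm_unitary_conj hW]; exact hAm _ _
  have hT : |∑ i : Fin (2 * L - 1), ∑ e : Edge 3 L,
        -(((A i.castSucc e - A i.succ e) * (A i.castSucc e * A i.succ e - A i.succ e * A i.castSucc e)).trace.re / 2)| ≤
      Fintype.card (Fin (2 * L - 1)) * (Fintype.card (Edge 3 L) * (24 * m ^ 3)) :=
    abs_sum_le_card_mul' fun i => abs_sum_le_card_mul' fun e => abs_temporal_cubic_le (hAm _ _) (hAm _ _)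
  have hS : |∑ e : Edge 3 L,
        ((A (Fin.last (2 * L - 1)) e + X₂ e - X₃ e - B e.1) *
          ((A (Fin.last (2 * L - 1)) e * X₂ e - X₂ e * A (Fin.last (2 * L - 1)) e) -
            (A (Fin.last (2 * L - 1)) e * X₃ e - X₃ e * A (Fin.last (2 * L - 1)) e) -
            (A (Fin.last (2 * L - 1)) e * B e.1 - B e.1 * A (Fin.last (2 * L - 1)) e) - (X₂ e * X₃ e - X₃ e * X₂ e) -
            (X₂ e * B e.1 - B e.1 * X₂ e) + (X₃ e * B e.1 - B e.1 * X₃ e))).trace.re / 2| ≤ Fintype.card (Edge 3 L) * (24 * m ^ 3) :=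
    abs_sum_le_card_mul' fun e => abs_cubicForm_le (hAm _ _) (hX₂n e) (hX₃n e) (hBm _)
  have hP : |∑ i : Fin (2 * L - 1 + 1), ∑ p : Plaquette 3 L,
        ((A i (p.1, p.2.1.1) + Y₂ i p - Y₃ i p - A i (p.1, p.2.1.2)) *
          ((A i (p.1, p.2.1.1) * Y₂ i p - Y₂ i p * A i (p.1, p.2.1.1)) - (A i (p.1, p.2.1.1) * Y₃ i p - Y₃ i p * A i (p.1, p.2.1.1)) -
            (A i (p.1, p.2.1.1) * A i (p.1, p.2.1.2) - A i (p.1, p.2.1.2) * A i (p.1, p.2.1.1)) - (Y₂ i p * Y₃ i p - Y₃ i p * Y₂ i p) -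
            (Y₂ i p * A i (p.1, p.2.1.2) - A i (p.1, p.2.1.2) * Y₂ i p) + (Y₃ i p * A i (p.1, p.2.1.2) - A i (p.1, p.2.1.2) * Y₃ i p))).trace.re / 2| ≤
      Fintype.card (Fin (2 * L - 1 + 1)) * (Fintype.card (Plaquette 3 L) * (24 * m ^ 3)) :=
    abs_sum_le_card_mul' fun i => abs_sum_le_card_mul' fun p => abs_cubicForm_le (hAm _ _) (hY₂n i p) (hY₃n i p) (hAm _ _)
  have hsum : Fintype.card (Fin (2 * L - 1)) * (Fintype.card (Edge 3 L) * (24 * m ^ 3)) + Fintype.card (Edge 3 L) * (24 * m ^ 3) +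
      Fintype.card (Fin (2 * L - 1 + 1)) * (Fintype.card (Plaquette 3 L) * (24 * m ^ 3)) = 288 * (L : ℝ) ^ 4 * m ^ 3 := by
    rw [familyCards_mul_eq L (24 * m ^ 3)]; ring
  rw [← hsum]
  exact (abs_add_le _ _).trans (add_le_add ((abs_add_le _ _).trans (add_le_add hT hS)) hP)

end Summit.QuantumFields.YangMills.Theorems.VirialFluxGap.ChartPhase

end
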